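import Mathlib
import HarnessLib
import Summits.HubbardSuperconductivity.HubbardSuperconductivity.Theorems.KLProgrammeKLRegimeTorusL1ThirdDifferencesMoment
import Summits.HubbardSuperconductivity.HubbardSuperconductivity.Theorems.KLProgrammeKLRegimeTorusMixedWeightMoment

/-!
# Route `KLProgramme` — engine support (route (L2), ADDITIVE weight, FIRST MOMENT, MIXED ORDERS along the tangent): the `klScaleWt`-type WEIGHTED
# `ℓ¹` norm of a space-time character sum from the sup, the support count and pointwise single-direction differences of its symbol — THIRD
# differences in time, along the axes, along `v⊥` and along `v` at the ISOTROPIC rates, SECOND differences along `v` at the ANISOTROPIC rate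

Cell `gate-hubbard-kl`, seat p3 (g10), for the ENGINE child stmt-HubbardSuperconductivity-20437 (`stub_engine_step_norms`: the WEIGHTED lines
`KernelNormsWt4 … K_n j`, `j ≥ 1`, and conjunct 3 (E4)ₙ via W1; located risk «(b)-Wt@j≥1»).  The order-three master lemma
`sum_wt_norm_charSum_le_of_third_differences` (p3 g9) needs third differences along the sector tangent `v` at the anisotropic rate `s₃`, which the
flow frame's isotropic (I-F jets) do not supply n-free (finding W1-TAN3, KL STATUS 2026-08-27 15:19Z: overshoot `U²2ⁿ`).  This is the master lemma of
the CURE: along `v` the symbol carries SECOND differences at the anisotropic rate `s₃` (the sector's `C²` geometry, p4's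
`norm_fwdDiff_two_space_sampledSymbol_le'`) and THIRD differences at the isotropic rate `s₃'` (`C³` data at the normal scale); the `Σ w²W⁻¹` factor is
`sum_sq_mul_inv_mixedWeight_le` (`…TorusMixedWeightMoment`, weight `1 + X⁶ + I₁⁶ + I₂⁶ + Y⁶ + Z⁴ + Z'⁶`).

* §1 `sum_sum_addWeight_mul_norm_sq_le'`, `sum_sum_mul_norm_prodChar_le_additive'` — the Literature Cauchy–Schwarz/Plancherel step
  (`TorusFourierAdditiveTimeMoment`) with PER-DIRECTION difference orders `N i` (verbatim twins; the Literature lemma fixes one `N₁` for all directions);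
* §2 `rate_pow_mul_sum_norm_sq_fwdDiff_le` (one direction's symbol factor `(sQ/4)^{2N}Σ‖Δ^N G‖² ≤ (N+1)N_sA₀²`) and the master lemma
  **`sum_wt_norm_charSum_le_of_mixed_differences`**: for rates `s₀, s₁, s₂, s₃, s₃' > 0`, `v ≠ 0`, `2(|v₁|+|v₂|)R₀ < L`, a symbol `G` with `‖G‖ ≤ A₀`,
  `#{G ≠ 0} ≤ N_s`, `‖Δ³‖ ≤ A₀(4/(s_wQ_w))³` in the directions time/`e₁`/`e₂`/`v⊥`/`v` (rates `s₀/s₁/s₁/s₂/s₃'`) and `‖Δ²_{(0,v)}G‖ ≤ A₀(4/(s₃L))²`: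
  `Σ_z (1 + s₀|z̃₁| + s₁|(z₂)̃₁| + s₁|(z₂)̃₂|)·‖Σ_q χ_{q₁}(z₁)χ_{q₂}(z₂) • G(q)‖
     ≤ √(524288(1/s₀+1)[C_w'²·(2√2/(s₂|v|)+2)(2√2/(s₃|v|)+2) + (1/s₁+1)²/(1+s₁R₀)])·√(24·P·L²·N_s)·A₀`,
  `C_w' = 1 + 2√2·s₁/(s₂|v|) + 2√2·s₁/(s₃'|v|)` (`24 = 1 + 4 + 4+4+4 + 3 + 4`).

Everything is proved; no definitions, no named facts. [folklore]

References: G. Benfatto, A. Giuliani, V. Mastropietro, Ann. Henri Poincaré 7 (2006) 809–898, Lemma 2.2 (2.52)–(2.55), (2.36aa), §2.6 (2.81) and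
footnote ¹.
-/

noncomputable section

namespace Summit.HubbardSuperconductivity.HubbardSuperconductivity.Theorems.TorusFourierL2

set_option linter.dupNamespace false -- summit = problem name (single-conjunct summit), D-0017

open Finset Literature.Probability.LatticeModels Literature.MathematicalPhysics.QuantumLattice
open scoped Real

/-! ### §1 The weighted Plancherel / Cauchy–Schwarz step with PER-DIRECTION difference orders -/

section CS

variable {d₁ L₁ d₂ L₂ : ℕ} [NeZero L₁] [NeZero L₂]

/-- **Weighted Plancherel with an additive weight of per-direction orders**: for `c₀, c_i ≥ 0` and orders `N₀`, `N i`,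
`Σ_{a,b} W(a,b)‖S[G](a,b)‖² ≤ L₁^{d₁}L₂^{d₂}(Σ‖G‖² + c₀Σ‖Δ_u^{N₀}G‖² + Σ_i c_iΣ‖Δ_{v_i}^{N_i}G‖²)`,
`W = 1 + c₀(4|ã_u|/L₁)^{2N₀} + Σ_i c_i(4|b̃_{v_i}|/L₂)^{2N_i}` (the twin of `sum_sum_addWeight_mul_norm_sq_le` with `N₁ ↦ N i`).
[cite: BenfattoGiulianiMastropietro2006, Lemma 2.2 and (2.36aa)] -/
theorem sum_sum_addWeight_mul_norm_sq_le' {ι : Type*} (T : Finset ι) (u : TorusSite d₁ L₁) (c₀ : ℝ) (hc₀ : 0 ≤ c₀)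
    (v : ι → TorusSite d₂ L₂) (c : ι → ℝ) (hc : ∀ i ∈ T, 0 ≤ c i) (N₀ : ℕ) (N : ι → ℕ) (G : TorusSite d₁ L₁ → TorusSite d₂ L₂ → ℂ) :
    ∑ a : TorusSite d₁ L₁, ∑ b : TorusSite d₂ L₂,
        (1 + c₀ * (4 * |((∑ j, u j * a j).valMinAbs : ℝ)| / L₁) ^ (2 * N₀) +
            ∑ i ∈ T, c i * (4 * |((∑ j, v i j * b j).valMinAbs : ℝ)| / L₂) ^ (2 * N i)) *
          ‖∑ p, ∑ p', torusChar p a * torusChar p' b * G p p'‖ ^ 2 ≤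
      (L₁ : ℝ) ^ d₁ * (L₂ : ℝ) ^ d₂ *
        (∑ p, ∑ p', ‖G p p'‖ ^ 2 + c₀ * ∑ p, ∑ p', ‖((fwdDiff u)^[N₀] (fun q => G q p')) p‖ ^ 2 +
          ∑ i ∈ T, c i * ∑ p, ∑ p', ‖((fwdDiff (v i))^[N i] (G p)) p'‖ ^ 2) := by
  set S : TorusSite d₁ L₁ × TorusSite d₂ L₂ → ℂ := fun ab => ∑ p, ∑ p', torusChar p ab.1 * torusChar p' ab.2 * G p p' with hS
  set wu : TorusSite d₁ L₁ → ℝ := fun a => (4 * |((∑ j, u j * a j).valMinAbs : ℝ)| / L₁) ^ (2 * N₀) with hwu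
  set wv : ι → TorusSite d₂ L₂ → ℝ := fun i b => (4 * |((∑ j, v i j * b j).valMinAbs : ℝ)| / L₂) ^ (2 * N i) with hwv
  have hpt : ∀ (a : TorusSite d₁ L₁) (b : TorusSite d₂ L₂), (1 + c₀ * wu a + ∑ i ∈ T, c i * wv i b) * ‖S (a, b)‖ ^ 2 =
      ‖S (a, b)‖ ^ 2 + c₀ * (wu a * ‖S (a, b)‖ ^ 2) + ∑ i ∈ T, c i * (wv i b * ‖S (a, b)‖ ^ 2) := by
    intro a b
    rw [add_mul, add_mul, one_mul, sum_mul]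
    congr 1
    · ring
    · exact sum_congr rfl fun i _ => by ring
  have hinner : ∀ a : TorusSite d₁ L₁, ∑ b : TorusSite d₂ L₂, (1 + c₀ * wu a + ∑ i ∈ T, c i * wv i b) * ‖S (a, b)‖ ^ 2 =
      ∑ b : TorusSite d₂ L₂, ‖S (a, b)‖ ^ 2 + c₀ * ∑ b : TorusSite d₂ L₂, wu a * ‖S (a, b)‖ ^ 2 +
        ∑ i ∈ T, c i * ∑ b : TorusSite d₂ L₂, wv i b * ‖S (a, b)‖ ^ 2 := by
    intro a
    simp_rw [hpt]
    rw [sum_add_distrib, sum_add_distrib, mul_sum, sum_comm]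
    simp_rw [mul_sum]
  have hsplit : ∑ a : TorusSite d₁ L₁, ∑ b : TorusSite d₂ L₂, (1 + c₀ * wu a + ∑ i ∈ T, c i * wv i b) * ‖S (a, b)‖ ^ 2 =
      ∑ a : TorusSite d₁ L₁, ∑ b : TorusSite d₂ L₂, ‖S (a, b)‖ ^ 2 +
        c₀ * ∑ a : TorusSite d₁ L₁, ∑ b : TorusSite d₂ L₂, wu a * ‖S (a, b)‖ ^ 2 +
        ∑ i ∈ T, c i * ∑ a : TorusSite d₁ L₁, ∑ b : TorusSite d₂ L₂, wv i b * ‖S (a, b)‖ ^ 2 := by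
    simp_rw [hinner]
    have h3 : ∑ a : TorusSite d₁ L₁, ∑ i ∈ T, c i * ∑ b : TorusSite d₂ L₂, wv i b * ‖S (a, b)‖ ^ 2 =
        ∑ i ∈ T, c i * ∑ a : TorusSite d₁ L₁, ∑ b : TorusSite d₂ L₂, wv i b * ‖S (a, b)‖ ^ 2 := by
      rw [sum_comm]
      refine sum_congr rfl fun i _ => ?_
      rw [mul_sum]
    rw [sum_add_distrib, sum_add_distrib, h3, ← mul_sum]
  have hgoal : ∑ a : TorusSite d₁ L₁, ∑ b : TorusSite d₂ L₂,
      (1 + c₀ * (4 * |((∑ j, u j * a j).valMinAbs : ℝ)| / L₁) ^ (2 * N₀) +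
          ∑ i ∈ T, c i * (4 * |((∑ j, v i j * b j).valMinAbs : ℝ)| / L₂) ^ (2 * N i)) *
        ‖∑ p, ∑ p', torusChar p a * torusChar p' b * G p p'‖ ^ 2 =
      ∑ a : TorusSite d₁ L₁, ∑ b : TorusSite d₂ L₂, (1 + c₀ * wu a + ∑ i ∈ T, c i * wv i b) * ‖S (a, b)‖ ^ 2 := rfl
  rw [hgoal, hsplit]
  have h0 := sum_sum_norm_sq_prodChar G
  have h1 := sum_sum_weight_fst_mul_norm_sq_le G u N₀
  have h2 := fun i => sum_sum_weight_snd_mul_norm_sq_le G (v i) (N i)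
  simp only [hS, hwu, hwv] at h0 h1 h2 ⊢
  rw [h0, mul_add, mul_add]
  refine add_le_add (add_le_add le_rfl ?_) ?_
  · rw [mul_left_comm]
    exact mul_le_mul_of_nonneg_left h1 hc₀
  · rw [mul_sum]
    refine sum_le_sum fun i hi => ?_
    rw [mul_left_comm]
    exact mul_le_mul_of_nonneg_left (h2 i) (hc i hi)

/-- **A position moment from PURE differences with per-direction orders**: for a nonnegative weight function `m` and `c₀, c_i ≥ 0`,
`Σ_{a,b} m(a,b)‖S[G](a,b)‖ ≤ √(Σ_{a,b} m(a,b)²·W(a,b)⁻¹) · √(L₁^{d₁}L₂^{d₂}(Σ‖G‖² + c₀Σ‖Δ_u^{N₀}G‖² + Σ_i c_iΣ‖Δ_{v_i}^{N_i}G‖²))`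
(`sum_sum_mul_norm_prodChar_le_additive` with `N₁ ↦ N i`). [cite: BenfattoGiulianiMastropietro2006, Lemma 2.2, (2.36aa) and (3.3)] -/
theorem sum_sum_mul_norm_prodChar_le_additive' {ι : Type*} (T : Finset ι) (u : TorusSite d₁ L₁) (c₀ : ℝ) (hc₀ : 0 ≤ c₀)
    (v : ι → TorusSite d₂ L₂) (c : ι → ℝ) (hc : ∀ i ∈ T, 0 ≤ c i) (N₀ : ℕ) (N : ι → ℕ)
    (m : TorusSite d₁ L₁ → TorusSite d₂ L₂ → ℝ) (hm : ∀ a b, 0 ≤ m a b) (G : TorusSite d₁ L₁ → TorusSite d₂ L₂ → ℂ) :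
    ∑ a : TorusSite d₁ L₁, ∑ b : TorusSite d₂ L₂, m a b * ‖∑ p, ∑ p', torusChar p a * torusChar p' b * G p p'‖ ≤
      Real.sqrt (∑ a : TorusSite d₁ L₁, ∑ b : TorusSite d₂ L₂, m a b ^ 2 *
          (1 + c₀ * (4 * |((∑ j, u j * a j).valMinAbs : ℝ)| / L₁) ^ (2 * N₀) +
            ∑ i ∈ T, c i * (4 * |((∑ j, v i j * b j).valMinAbs : ℝ)| / L₂) ^ (2 * N i))⁻¹) *
        Real.sqrt ((L₁ : ℝ) ^ d₁ * (L₂ : ℝ) ^ d₂ *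
          (∑ p, ∑ p', ‖G p p'‖ ^ 2 + c₀ * ∑ p, ∑ p', ‖((fwdDiff u)^[N₀] (fun q => G q p')) p‖ ^ 2 +
            ∑ i ∈ T, c i * ∑ p, ∑ p', ‖((fwdDiff (v i))^[N i] (G p)) p'‖ ^ 2)) := by
  set W : TorusSite d₁ L₁ × TorusSite d₂ L₂ → ℝ := fun ab =>
    1 + c₀ * (4 * |((∑ j, u j * ab.1 j).valMinAbs : ℝ)| / L₁) ^ (2 * N₀) +
      ∑ i ∈ T, c i * (4 * |((∑ j, v i j * ab.2 j).valMinAbs : ℝ)| / L₂) ^ (2 * N i) with hW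
  set S : TorusSite d₁ L₁ × TorusSite d₂ L₂ → ℂ := fun ab => ∑ p, ∑ p', torusChar p ab.1 * torusChar p' ab.2 * G p p' with hS
  have hWpos : ∀ ab ∈ (univ : Finset (TorusSite d₁ L₁ × TorusSite d₂ L₂)), 0 < W ab := fun ab _ => by
    rw [hW]
    exact add_pos_of_pos_of_nonneg (add_pos_of_pos_of_nonneg one_pos (mul_nonneg hc₀ (by positivity)))
      (sum_nonneg fun i hi => mul_nonneg (hc i hi) (by positivity))
  have hcs := sum_mul_norm_le_of_weight univ S (fun ab => m ab.1 ab.2) W (fun ab _ => hm ab.1 ab.2) hWpos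
  rw [← univ_product_univ, sum_product, sum_product, sum_product] at hcs
  refine hcs.trans (mul_le_mul_of_nonneg_left (Real.sqrt_le_sqrt ?_) (Real.sqrt_nonneg _))
  exact sum_sum_addWeight_mul_norm_sq_le' T u c₀ hc₀ v c hc N₀ N G

end CS

/-! ### §2 The master lemma with mixed orders along the tangent -/

/-- The symbol factor of one direction: if `‖Δ_w^N G‖ ≤ A₀(4/(sQ))^N` pointwise, `#supp G ≤ N_s`, then
`(sQ/4)^{2N}·Σ‖Δ_w^N G‖² ≤ (N+1)·N_s·A₀²`. [folklore] -/
theorem rate_pow_mul_sum_norm_sq_fwdDiff_le {α : Type*} [AddCommGroup α] [Fintype α] [DecidableEq α] (G : α → ℂ) (w : α) (N : ℕ)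
    {Ns : ℕ} (hsupp : (univ.filter fun x => G x ≠ 0).card ≤ Ns) {A₀ s Q : ℝ} (hs : 0 < s) (hQ : 0 < Q)
    (hpt : ∀ x, ‖(fwdDiff w)^[N] G x‖ ≤ A₀ * (4 / (s * Q)) ^ N) :
    (s * Q / 4) ^ (2 * N) * ∑ x, ‖(fwdDiff w)^[N] G x‖ ^ 2 ≤ (N + 1) * Ns * A₀ ^ 2 := by
  have h := sum_norm_sq_fwdDiff_iter_le G w N hsupp hpt
  have hunit : (s * Q / 4) ^ (2 * N) * ((4 / (s * Q)) ^ N) ^ 2 = 1 := by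
    rw [← pow_mul, mul_comm N 2, ← mul_pow]
    have : s * Q / 4 * (4 / (s * Q)) = 1 := by field_simp
    rw [this, one_pow]
  calc (s * Q / 4) ^ (2 * N) * ∑ x, ‖(fwdDiff w)^[N] G x‖ ^ 2
      ≤ (s * Q / 4) ^ (2 * N) * ((N + 1) * Ns * (A₀ * (4 / (s * Q)) ^ N) ^ 2) := mul_le_mul_of_nonneg_left h (by positivity)
    _ = (N + 1) * Ns * A₀ ^ 2 * ((s * Q / 4) ^ (2 * N) * ((4 / (s * Q)) ^ N) ^ 2) := by ring
    _ = (N + 1) * Ns * A₀ ^ 2 := by rw [hunit, mul_one]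

/-- **The weighted `ℓ¹` norm (one position moment) of a space-time character sum from the sup, the support count and pointwise single-direction
differences of its symbol, with MIXED ORDERS along the tangent.**  Data: rates `s₀, s₁, s₂, s₃, s₃' > 0`, an integer direction `v ≠ 0` with frame
`(v⊥, v)`, a near radius `R₀` with `2(|v₁|+|v₂|)R₀ < L`; a symbol `G` on `(ℤ/Pℤ)¹ × (ℤ/Lℤ)²` with `‖G‖ ≤ A₀`, `#{G ≠ 0} ≤ N_s`, THIRD differences
`‖Δ³_{(1,0)} G‖ ≤ A₀(4/(s₀P))³`, `‖Δ³_{(0,eᵢ)} G‖ ≤ A₀(4/(s₁L))³` (`i = 1,2`), `‖Δ³_{(0,v⊥)} G‖ ≤ A₀(4/(s₂L))³`, `‖Δ³_{(0,v)} G‖ ≤ A₀(4/(s₃'L))³`, and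
SECOND differences `‖Δ²_{(0,v)} G‖ ≤ A₀(4/(s₃L))²` along the tangent.
THEN `Σ_z (1 + s₀|z̃₁| + s₁|(z₂)̃₁| + s₁|(z₂)̃₂|)·‖Σ_q χ_{q₁}(z₁)χ_{q₂}(z₂) • G(q)‖
  ≤ √(524288(1/s₀+1)[C_w'²·(2√2/(s₂|v|)+2)(2√2/(s₃|v|)+2) + (1/s₁+1)²/(1+s₁R₀)])·√(24·P·L²·N_s)·A₀`, `C_w' = 1 + 2√2·s₁/(s₂|v|) + 2√2·s₁/(s₃'|v|)`
(Cauchy–Schwarz with the monomial against the mixed additive weight, Plancherel direction by direction, `sum_sq_mul_inv_mixedWeight_le`).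
[cite: BenfattoGiulianiMastropietro2006, Lemma 2.2 (2.52)–(2.55), §2.6 (2.81) and footnote 1] -/
theorem sum_wt_norm_charSum_le_of_mixed_differences {P L : ℕ} [NeZero P] [NeZero L] (G : TorusSite 1 P × TorusSite 2 L → ℂ)
    (v : Fin 2 → ℤ) (hv : v ≠ 0) {s₀ s₁ s₂ s₃ s₃' : ℝ} (hs₀ : 0 < s₀) (hs₁ : 0 < s₁) (hs₂ : 0 < s₂) (hs₃ : 0 < s₃) (hs₃' : 0 < s₃')
    {R₀ : ℕ} (hR₀ : 2 * (|v 0| + |v 1|) * (R₀ : ℤ) < L) {A₀ : ℝ} (hA₀ : 0 ≤ A₀) {Ns : ℕ}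
    (hsupp : (univ.filter fun q => G q ≠ 0).card ≤ Ns) (hsup : ∀ q, ‖G q‖ ≤ A₀)
    (h₀ : ∀ q, ‖(fwdDiff ((fun _ : Fin 1 => (1 : ZMod P)), (0 : TorusSite 2 L)))^[3] G q‖ ≤ A₀ * (4 / (s₀ * P)) ^ 3)
    (h₁ : ∀ q (i : Fin 2), ‖(fwdDiff ((0 : TorusSite 1 P), (Pi.single i (1 : ZMod L) : TorusSite 2 L)))^[3] G q‖ ≤
      A₀ * (4 / (s₁ * L)) ^ 3)
    (h₂ : ∀ q, ‖(fwdDiff ((0 : TorusSite 1 P), (fun j => ((![-v 1, v 0] j : ℤ) : ZMod L))))^[3] G q‖ ≤ A₀ * (4 / (s₂ * L)) ^ 3)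
    (h₃ : ∀ q, ‖(fwdDiff ((0 : TorusSite 1 P), (fun j => ((v j : ℤ) : ZMod L))))^[2] G q‖ ≤ A₀ * (4 / (s₃ * L)) ^ 2)
    (h₃' : ∀ q, ‖(fwdDiff ((0 : TorusSite 1 P), (fun j => ((v j : ℤ) : ZMod L))))^[3] G q‖ ≤ A₀ * (4 / (s₃' * L)) ^ 3) :
    ∑ z : TorusSite 1 P × TorusSite 2 L,
      (1 + s₀ * |(((z.1 0).valMinAbs : ℤ) : ℝ)| + s₁ * |(((z.2 0).valMinAbs : ℤ) : ℝ)| + s₁ * |(((z.2 1).valMinAbs : ℤ) : ℝ)|) *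
        ‖∑ q : TorusSite 1 P × TorusSite 2 L, (torusChar q.1 z.1 * torusChar q.2 z.2) • G q‖ ≤
      Real.sqrt (524288 * (1 / s₀ + 1) *
          ((1 + 2 * Real.sqrt 2 * s₁ / (s₂ * Real.sqrt ((v 0 : ℝ) ^ 2 + (v 1 : ℝ) ^ 2)) +
              2 * Real.sqrt 2 * s₁ / (s₃' * Real.sqrt ((v 0 : ℝ) ^ 2 + (v 1 : ℝ) ^ 2))) ^ 2 *
            ((2 * Real.sqrt 2 / (s₂ * Real.sqrt ((v 0 : ℝ) ^ 2 + (v 1 : ℝ) ^ 2)) + 2) *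
              (2 * Real.sqrt 2 / (s₃ * Real.sqrt ((v 0 : ℝ) ^ 2 + (v 1 : ℝ) ^ 2)) + 2))
            + (1 / s₁ + 1) ^ 2 / (1 + s₁ * R₀))) *
        Real.sqrt (24 * P * (L : ℝ) ^ 2 * Ns) * A₀ := by
  classical
  -- the five space slots, indexed by `Fin 5`: e₁ (order 3), e₂ (3), v⊥ (3), v (2), v (3)
  obtain ⟨dir, hdir⟩ : ∃ dir : Fin 5 → TorusSite 2 L, dir = ![(Pi.single 0 (1 : ZMod L) : TorusSite 2 L),
    (Pi.single 1 (1 : ZMod L) : TorusSite 2 L), (fun j => ((![-v 1, v 0] j : ℤ) : ZMod L)), (fun j => ((v j : ℤ) : ZMod L)),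
    (fun j => ((v j : ℤ) : ZMod L))] := ⟨_, rfl⟩
  obtain ⟨rate, hrate⟩ : ∃ rate : Fin 5 → ℝ, rate = ![s₁, s₁, s₂, s₃, s₃'] := ⟨_, rfl⟩
  obtain ⟨N, hN⟩ : ∃ N : Fin 5 → ℕ, N = ![3, 3, 3, 2, 3] := ⟨_, rfl⟩
  obtain ⟨u, hu⟩ : ∃ u : TorusSite 1 P, u = fun _ => (1 : ZMod P) := ⟨_, rfl⟩
  obtain ⟨c₀, hc₀⟩ : ∃ c₀ : ℝ, c₀ = (s₀ * P / 4) ^ (2 * 3) := ⟨_, rfl⟩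
  obtain ⟨c, hc⟩ : ∃ c : Fin 5 → ℝ, c = fun i => (rate i * L / 4) ^ (2 * N i) := ⟨_, rfl⟩
  -- the moment monomial
  obtain ⟨m, hm⟩ : ∃ m : TorusSite 1 P → TorusSite 2 L → ℝ, m = fun a b =>
      1 + s₀ * |(((a 0).valMinAbs : ℤ) : ℝ)| + s₁ * |(((b 0).valMinAbs : ℤ) : ℝ)| + s₁ * |(((b 1).valMinAbs : ℤ) : ℝ)| := ⟨_, rfl⟩
  have hm0 : ∀ a b, 0 ≤ m a b := fun a b => by rw [hm]; positivity
  have hrate_pos : ∀ i, 0 < rate i := fun i => by subst hrate; fin_cases i <;> simp [hs₁, hs₂, hs₃, hs₃']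
  have hc₀0 : 0 ≤ c₀ := by rw [hc₀]; positivity
  have hci0 : ∀ i, 0 ≤ c i := fun i => by
    rw [hc]; have := hrate_pos i; exact pow_nonneg (by positivity) _
  have hc0 : ∀ i ∈ (univ : Finset (Fin 5)), 0 ≤ c i := fun i _ => hci0 i
  obtain ⟨Gc, hGc⟩ : ∃ Gc : TorusSite 1 P → TorusSite 2 L → ℂ, Gc = fun a b => G (a, b) := ⟨_, rfl⟩
  have hmain := sum_sum_mul_norm_prodChar_le_additive' (univ : Finset (Fin 5)) u c₀ hc₀0 dir c hc0 3 N m hm0 Gc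
  -- (1) rewrite the left-hand side into the pair form
  have hLHS : ∑ z : TorusSite 1 P × TorusSite 2 L,
      (1 + s₀ * |(((z.1 0).valMinAbs : ℤ) : ℝ)| + s₁ * |(((z.2 0).valMinAbs : ℤ) : ℝ)| + s₁ * |(((z.2 1).valMinAbs : ℤ) : ℝ)|) *
        ‖∑ q : TorusSite 1 P × TorusSite 2 L, (torusChar q.1 z.1 * torusChar q.2 z.2) • G q‖ =
      ∑ a : TorusSite 1 P, ∑ b : TorusSite 2 L, m a b * ‖∑ p, ∑ p', torusChar p a * torusChar p' b * Gc p p'‖ := by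
    rw [Fintype.sum_prod_type]
    refine sum_congr rfl fun a _ => sum_congr rfl fun b _ => ?_
    rw [charSum_pair_eq_curried, hGc, hm]
  rw [hLHS]
  refine hmain.trans ?_
  -- (2) the weight factor
  have hP : (0 : ℝ) < P := Nat.cast_pos.2 (Nat.pos_of_ne_zero (NeZero.ne P))
  have hL : (0 : ℝ) < L := Nat.cast_pos.2 (Nat.pos_of_ne_zero (NeZero.ne L))
  have hweight_eq : ∀ (a : TorusSite 1 P) (b : TorusSite 2 L),
      m a b ^ 2 * (1 + c₀ * (4 * |((∑ j, u j * a j).valMinAbs : ℝ)| / P) ^ (2 * 3) +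
        ∑ i ∈ (univ : Finset (Fin 5)), c i * (4 * |((∑ j, dir i j * b j).valMinAbs : ℝ)| / L) ^ (2 * N i))⁻¹ =
      (1 + s₀ * |(((a 0).valMinAbs : ℤ) : ℝ)| + s₁ * |(((b 0).valMinAbs : ℤ) : ℝ)| + s₁ * |(((b 1).valMinAbs : ℤ) : ℝ)|) ^ 2 *
      (1 + (s₀ * |(((a 0).valMinAbs : ℤ) : ℝ)|) ^ 6 + (s₁ * |(((b 0).valMinAbs : ℤ) : ℝ)|) ^ 6 +
        (s₁ * |(((b 1).valMinAbs : ℤ) : ℝ)|) ^ 6 +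
        (s₂ * |(((∑ j, ((![-v 1, v 0] j : ℤ) : ZMod L) * b j).valMinAbs : ℤ) : ℝ)|) ^ 6 +
        (s₃ * |(((∑ j, ((v j : ℤ) : ZMod L) * b j).valMinAbs : ℤ) : ℝ)|) ^ 4 +
        (s₃' * |(((∑ j, ((v j : ℤ) : ZMod L) * b j).valMinAbs : ℤ) : ℝ)|) ^ 6)⁻¹ := by
    intro a b
    have hua : (∑ j, u j * a j) = a 0 := by simp [hu]
    have hb0 : (∑ j, dir 0 j * b j) = b 0 := by simp [hdir, Pi.single_apply]
    have hb1 : (∑ j, dir 1 j * b j) = b 1 := by simp [hdir, Pi.single_apply]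
    have hb2 : (∑ j, dir 2 j * b j) = ∑ j, ((![-v 1, v 0] j : ℤ) : ZMod L) * b j := by simp [hdir]
    have hb3 : (∑ j, dir 3 j * b j) = ∑ j, ((v j : ℤ) : ZMod L) * b j := by simp [hdir]
    have hb4 : (∑ j, dir 4 j * b j) = ∑ j, ((v j : ℤ) : ZMod L) * b j := by simp [hdir]
    rw [Fin.sum_univ_five, hua, hb0, hb1, hb2, hb3, hb4, hc, hc₀, hm]
    have hr0 : rate 0 = s₁ := by rw [hrate]; rfl
    have hr1 : rate 1 = s₁ := by rw [hrate]; rfl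
    have hr2 : rate 2 = s₂ := by rw [hrate]; rfl
    have hr3 : rate 3 = s₃ := by rw [hrate]; rfl
    have hr4 : rate 4 = s₃' := by rw [hrate]; rfl
    have hN0 : N 0 = 3 := by rw [hN]; rfl
    have hN1 : N 1 = 3 := by rw [hN]; rfl
    have hN2 : N 2 = 3 := by rw [hN]; rfl
    have hN3 : N 3 = 2 := by rw [hN]; rfl
    have hN4 : N 4 = 3 := by rw [hN]; rfl
    simp only [hr0, hr1, hr2, hr3, hr4, hN0, hN1, hN2, hN3, hN4]
    have key : ∀ (s Q x : ℝ) (k : ℕ), 0 < Q → (s * Q / 4) ^ (2 * k) * (4 * x / Q) ^ (2 * k) = (s * x) ^ (2 * k) := by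
      intro s Q x k hQ
      rw [← mul_pow]
      congr 1
      field_simp
    rw [key _ _ _ 3 hP, key _ _ _ 3 hL, key _ _ _ 3 hL, key _ _ _ 3 hL, key _ _ _ 2 hL, key _ _ _ 3 hL]
    push_cast
    ring
  have hW := sum_sq_mul_inv_mixedWeight_le (P := P) (L := L) v hv hs₀ hs₁ hs₂ hs₃ hs₃' hR₀
  have hweight : Real.sqrt (∑ a : TorusSite 1 P, ∑ b : TorusSite 2 L,
      m a b ^ 2 * (1 + c₀ * (4 * |((∑ j, u j * a j).valMinAbs : ℝ)| / P) ^ (2 * 3) +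
        ∑ i ∈ (univ : Finset (Fin 5)), c i * (4 * |((∑ j, dir i j * b j).valMinAbs : ℝ)| / L) ^ (2 * N i))⁻¹) ≤
      Real.sqrt (524288 * (1 / s₀ + 1) *
          ((1 + 2 * Real.sqrt 2 * s₁ / (s₂ * Real.sqrt ((v 0 : ℝ) ^ 2 + (v 1 : ℝ) ^ 2)) +
              2 * Real.sqrt 2 * s₁ / (s₃' * Real.sqrt ((v 0 : ℝ) ^ 2 + (v 1 : ℝ) ^ 2))) ^ 2 *
            ((2 * Real.sqrt 2 / (s₂ * Real.sqrt ((v 0 : ℝ) ^ 2 + (v 1 : ℝ) ^ 2)) + 2) *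
              (2 * Real.sqrt 2 / (s₃ * Real.sqrt ((v 0 : ℝ) ^ 2 + (v 1 : ℝ) ^ 2)) + 2))
            + (1 / s₁ + 1) ^ 2 / (1 + s₁ * R₀))) := by
    refine Real.sqrt_le_sqrt ?_
    simp_rw [hweight_eq]
    rw [← Fintype.sum_prod_type']
    exact hW
  -- (3) the symbol factor
  have hsq0 : ∑ p, ∑ p', ‖Gc p p'‖ ^ 2 ≤ Ns * A₀ ^ 2 := by
    rw [← Fintype.sum_prod_type' (f := fun p p' => ‖Gc p p'‖ ^ 2), hGc]
    exact sum_norm_sq_le_of_support_card G hsupp hsup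
  have htime : c₀ * ∑ p, ∑ p', ‖((fwdDiff u)^[3] (fun q => Gc q p')) p‖ ^ 2 ≤ 4 * Ns * A₀ ^ 2 := by
    have hpt : ∀ q : TorusSite 1 P × TorusSite 2 L, ‖(fwdDiff (u, (0 : TorusSite 2 L)))^[3] G q‖ ≤ A₀ * (4 / (s₀ * P)) ^ 3 :=
      fun q => by rw [hu]; exact h₀ q
    have heq : ∑ p, ∑ p', ‖((fwdDiff u)^[3] (fun q => Gc q p')) p‖ ^ 2 =
        ∑ q : TorusSite 1 P × TorusSite 2 L, ‖(fwdDiff (u, (0 : TorusSite 2 L)))^[3] G q‖ ^ 2 := by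
      rw [Fintype.sum_prod_type]
      refine sum_congr rfl fun p _ => sum_congr rfl fun p' _ => ?_
      rw [Literature.Probability.LatticeModels.fwdDiff_iter_prod_fst, hGc]
    rw [heq, hc₀]
    have h := rate_pow_mul_sum_norm_sq_fwdDiff_le G (u, (0 : TorusSite 2 L)) 3 hsupp hs₀ hP hpt
    norm_num at h ⊢
    exact h
  have hspace : ∀ i : Fin 5, c i * ∑ p, ∑ p', ‖((fwdDiff (dir i))^[N i] (Gc p)) p'‖ ^ 2 ≤ (N i + 1) * Ns * A₀ ^ 2 := by
    intro i
    have hpt : ∀ q : TorusSite 1 P × TorusSite 2 L, ‖(fwdDiff ((0 : TorusSite 1 P), dir i))^[N i] G q‖ ≤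
        A₀ * (4 / (rate i * L)) ^ (N i) := by
      have hd0 : dir 0 = (Pi.single 0 (1 : ZMod L) : TorusSite 2 L) := by rw [hdir]; rfl
      have hd1 : dir 1 = (Pi.single 1 (1 : ZMod L) : TorusSite 2 L) := by rw [hdir]; rfl
      have hd2 : dir 2 = (fun j => ((![-v 1, v 0] j : ℤ) : ZMod L)) := by rw [hdir]; rfl
      have hd3 : dir 3 = (fun j => ((v j : ℤ) : ZMod L)) := by rw [hdir]; rfl
      have hd4 : dir 4 = (fun j => ((v j : ℤ) : ZMod L)) := by rw [hdir]; rfl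
      have hr0 : rate 0 = s₁ := by rw [hrate]; rfl
      have hr1 : rate 1 = s₁ := by rw [hrate]; rfl
      have hr2 : rate 2 = s₂ := by rw [hrate]; rfl
      have hr3 : rate 3 = s₃ := by rw [hrate]; rfl
      have hr4 : rate 4 = s₃' := by rw [hrate]; rfl
      have hN0 : N 0 = 3 := by rw [hN]; rfl
      have hN1 : N 1 = 3 := by rw [hN]; rfl
      have hN2 : N 2 = 3 := by rw [hN]; rfl
      have hN3 : N 3 = 2 := by rw [hN]; rfl
      have hN4 : N 4 = 3 := by rw [hN]; rfl
      intro q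
      fin_cases i
      · change ‖(fwdDiff ((0 : TorusSite 1 P), dir 0))^[N 0] G q‖ ≤ A₀ * (4 / (rate 0 * L)) ^ (N 0)
        rw [hd0, hr0, hN0]; exact h₁ q 0
      · change ‖(fwdDiff ((0 : TorusSite 1 P), dir 1))^[N 1] G q‖ ≤ A₀ * (4 / (rate 1 * L)) ^ (N 1)
        rw [hd1, hr1, hN1]; exact h₁ q 1
      · change ‖(fwdDiff ((0 : TorusSite 1 P), dir 2))^[N 2] G q‖ ≤ A₀ * (4 / (rate 2 * L)) ^ (N 2)
        rw [hd2, hr2, hN2]; exact h₂ q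
      · change ‖(fwdDiff ((0 : TorusSite 1 P), dir 3))^[N 3] G q‖ ≤ A₀ * (4 / (rate 3 * L)) ^ (N 3)
        rw [hd3, hr3, hN3]; exact h₃ q
      · change ‖(fwdDiff ((0 : TorusSite 1 P), dir 4))^[N 4] G q‖ ≤ A₀ * (4 / (rate 4 * L)) ^ (N 4)
        rw [hd4, hr4, hN4]; exact h₃' q
    have heq : ∑ p, ∑ p', ‖((fwdDiff (dir i))^[N i] (Gc p)) p'‖ ^ 2 =
        ∑ q : TorusSite 1 P × TorusSite 2 L, ‖(fwdDiff ((0 : TorusSite 1 P), dir i))^[N i] G q‖ ^ 2 := by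
      rw [Fintype.sum_prod_type]
      refine sum_congr rfl fun p _ => sum_congr rfl fun p' _ => ?_
      rw [Literature.Probability.LatticeModels.fwdDiff_iter_prod_snd, hGc]
    rw [heq, hc]
    exact rate_pow_mul_sum_norm_sq_fwdDiff_le G ((0 : TorusSite 1 P), dir i) (N i) hsupp (hrate_pos i) hL hpt
  have hsymbol : Real.sqrt ((P : ℝ) ^ 1 * (L : ℝ) ^ 2 *
      (∑ p, ∑ p', ‖Gc p p'‖ ^ 2 + c₀ * ∑ p, ∑ p', ‖((fwdDiff u)^[3] (fun q => Gc q p')) p‖ ^ 2 +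
        ∑ i ∈ (univ : Finset (Fin 5)), c i * ∑ p, ∑ p', ‖((fwdDiff (dir i))^[N i] (Gc p)) p'‖ ^ 2)) ≤
      Real.sqrt (24 * P * (L : ℝ) ^ 2 * Ns) * A₀ := by
    have hbr : ∑ p, ∑ p', ‖Gc p p'‖ ^ 2 + c₀ * ∑ p, ∑ p', ‖((fwdDiff u)^[3] (fun q => Gc q p')) p‖ ^ 2 +
        ∑ i ∈ (univ : Finset (Fin 5)), c i * ∑ p, ∑ p', ‖((fwdDiff (dir i))^[N i] (Gc p)) p'‖ ^ 2 ≤ 24 * Ns * A₀ ^ 2 := by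
      have h5 : ∑ i ∈ (univ : Finset (Fin 5)), c i * ∑ p, ∑ p', ‖((fwdDiff (dir i))^[N i] (Gc p)) p'‖ ^ 2 ≤
          ∑ i ∈ (univ : Finset (Fin 5)), ((N i : ℝ) + 1) * Ns * A₀ ^ 2 := sum_le_sum fun i _ => hspace i
      have hNs : ∑ i ∈ (univ : Finset (Fin 5)), ((N i : ℝ) + 1) * Ns * A₀ ^ 2 = 19 * Ns * A₀ ^ 2 := by
        rw [Fin.sum_univ_five, hN]
        simp only [Matrix.cons_val_zero, Matrix.cons_val_one, Matrix.cons_val]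
        push_cast
        ring
      rw [hNs] at h5
      linarith [hsq0, htime, h5]
    rw [← Real.sqrt_sq hA₀, ← Real.sqrt_mul (by positivity)]
    refine Real.sqrt_le_sqrt ?_
    rw [pow_one]
    calc (P : ℝ) * (L : ℝ) ^ 2 * _ ≤ (P : ℝ) * (L : ℝ) ^ 2 * (24 * Ns * A₀ ^ 2) :=
          mul_le_mul_of_nonneg_left hbr (by positivity)
      _ = 24 * P * (L : ℝ) ^ 2 * Ns * A₀ ^ 2 := by ring
  calc _ ≤ Real.sqrt (524288 * (1 / s₀ + 1) *
          ((1 + 2 * Real.sqrt 2 * s₁ / (s₂ * Real.sqrt ((v 0 : ℝ) ^ 2 + (v 1 : ℝ) ^ 2)) +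
              2 * Real.sqrt 2 * s₁ / (s₃' * Real.sqrt ((v 0 : ℝ) ^ 2 + (v 1 : ℝ) ^ 2))) ^ 2 *
            ((2 * Real.sqrt 2 / (s₂ * Real.sqrt ((v 0 : ℝ) ^ 2 + (v 1 : ℝ) ^ 2)) + 2) *
              (2 * Real.sqrt 2 / (s₃ * Real.sqrt ((v 0 : ℝ) ^ 2 + (v 1 : ℝ) ^ 2)) + 2))
            + (1 / s₁ + 1) ^ 2 / (1 + s₁ * R₀))) *
        (Real.sqrt (24 * P * (L : ℝ) ^ 2 * Ns) * A₀) :=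
        mul_le_mul hweight hsymbol (Real.sqrt_nonneg _) (Real.sqrt_nonneg _)
    _ = _ := by ring

end Summit.HubbardSuperconductivity.HubbardSuperconductivity.Theorems.TorusFourierL2

end
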